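/-
Copyright: the b2b-balaban cell (near-miss cell 7), T⁴-continuum fan-out, NE7b ROUND-2 swarm `t4-ne7b-formalise-*`
(seat leaf-07, gen 17), row S6 pt 3b∕3c «zones of realised histories» — parts III–IV over the zone skeleton and THE
PRINT-EXACT TWINS (twin chain R-40-a of the owner's located model finding F-ne7bp1g40-1, ruling R-OWNER-40-2) of
lineage t4-ne7b-p1's claim table `LEAVES-NE7b.md`.  Released under the licence of the surrounding project.
-/
import Summits.QuantumFields.BalabanUV.T4Continuum.Support.HistoryZonesOrbitRealiseZ
import Summits.QuantumFields.BalabanUV.T4Continuum.Support.HistoryZonesOrbitPedigree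

/-!
# History zones from orbits, VI: the consumers and the pedigree corollaries over the zone skeleton; the print-exact twins

Summits-side support leaf of the T⁴-continuum cell (rung (B)+1 on a FINITE torus only; NOT infinite volume, NOT the
mass gap, NOT the Clay statement; NOT a proof of the spine estimate NE7b, which is the cell's OWN estimate, NOT PRINTED
and NOT PROVED).  [folklore] bookkeeping on the lineage's OWN index model; nothing is quoted from print, nothing
printed is asserted, no `[cite:]` tag, no `Prop` fact minted, no definition.  Sequel of part V
(`HistoryZonesOrbitRealiseZ`: the zone skeleton `RealisesZ`, bridges `realisesZ_of_realises` ∕ `realisesZ_of_realisesP`,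
part II's walk `birthRegionsD_of_corrZ` ∕ `contact_of_corrZ`), which see for the WHY (owner's finding F-ne7bp1g40-1,
repair R-40-a; the lineage's site census, journal l.26565).

WHAT.  §1 part III's consumers over `RealisesZ`: **`admZ_of_corr_realisesZ`**, **`card_admZSet_le_of_corr_realisesZ`**
(= `HistoryZonesOrbitPlace.admZ_of_corr_realises` ∕ `card_admZSet_le_of_corr_realises` with `Realises L s R P Z ↦
RealisesZ L s P Z`, same scripts).  §2 THE PRINT-EXACT TWINS of parts II–III (hypothesis the owner's
`HistoryRealisePrint.RealisesP L s R P Z`; conclusions VERBATIM the landed ones; one-line bridges):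
**`birthRegionsD_of_corrP`**, **`contact_of_corrP`**, **`admZ_of_corr_realisesP`**, **`card_admZSet_le_of_corr_realisesP`**.
§3 part IV's pedigree corollaries over `RealisesZ` and their print-exact twins: `birthRegionsD_genTZ` ∕
**`birthRegionsD_genTP`**, `admZ_genT_of_realisesZ` ∕ **`admZ_genT_of_realisesP`**, `card_admZSet_genT_le_of_realisesZ` ∕
**`card_admZSet_genT_le_of_realisesP`** — the names row S12-P's END∕headline twins call in place of part IV's.  §4 sanity:
part II's LANDED `birthRegionsD_of_corr` (hypothesis `Realises`) recovered from the zone-skeleton law through bridge 1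
(the two sides of the twin chain share one proof).

BY-NAME EFFECT ON THE WALL: NONE (every `WALL-NE7b-P1.md` §2 binder keeps its class; the headline of record stands);
pre-positioning for row S12-P.  TYPED BY-PRODUCT (with part V): the zone multiplicity of the COUNT reads no clock.

HONEST DEPENDENCY (cell): continuum YM on T⁴ ⇐ BetaPertH ∧ nine spine estimates (0/9 proved); BetaPertH ⇐ (D1) ∧ (D4)
∧ CAP+tail; G-an2-4 gates asym, D1 and NE2/3/4.  This file changes none of it.  NE7b NOT proved.
-/

open Finset
open Literature.MathematicalPhysics.QuantumFieldTheory.Balaban1983to89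
open Literature.MathematicalPhysics.QuantumFieldTheory.Balaban1983to89.B13ScaleTransfer
open Literature.MathematicalPhysics.QuantumFieldTheory.Balaban1983to89.TreeLength
open Literature.MathematicalPhysics.QuantumFieldTheory.Balaban1983to89.B16SProfile
open Literature.MathematicalPhysics.QuantumFieldTheory.Balaban1983to89.B16MergeGeometry
open T4PersistenceDictionary T4PartnerMultiplicity
open Summit.QuantumFields.BalabanUV.T4Continuum.PlacementSkeleton
open Summit.QuantumFields.BalabanUV.T4Continuum.Crowding
open Summit.QuantumFields.BalabanUV.T4Continuum.ZoneSkeleton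
open Summit.QuantumFields.BalabanUV.T4Continuum.ZoneCrowd
open Summit.QuantumFields.BalabanUV.T4Continuum.ZoneTorus
open Summit.QuantumFields.BalabanUV.T4Continuum.HistoryAdmissible
open Summit.QuantumFields.BalabanUV.T4Continuum.HistoryRealise
open Summit.QuantumFields.BalabanUV.T4Continuum.HistoryRealisePrint
open Summit.QuantumFields.BalabanUV.T4Continuum.HistoryRealiseCells
open Summit.QuantumFields.BalabanUV.T4Continuum.HistoryGen

namespace Summit.QuantumFields.BalabanUV.T4Continuum.HistoryZones

noncomputable section

variable {d : ℕ}

variable {ε : Type*} [DecidableEq ε] {sh : ε → PEv} {pay : ε → Pt d × Finset (Pt d)}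

section Walk

variable {L : ℕ} (hL : 3 ≤ L) {n : ℕ} (hn : 0 < n) {s : ℕ → ℕ} (hs : ∀ t, s (t + 1) ≤ s t)
  (hdrop : ∀ m, DropCtl s m) {R : ℕ → ℕ} {K : ℕ}
include hL hn hs hdrop

/-! ## §1 Part III's consumers over the zone skeleton -/

open scoped Classical in
/-- **THE REALISED PLACEMENT OF A ZONE-SKELETON CORRESPONDING HISTORY IS ZONE-ADMISSIBLE AT LEVELS** (part III's
`admZ_of_corr_realises` with `Realises ↦ RealisesZ`). [folklore] -/
theorem admZ_of_corr_realisesZ {P : PGen (Pt d × Finset (Pt d))} {G : Gen ε} {Z : Finset (Pt d)}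
    (hc : Corr sh pay G P) (hR : RealisesZ L s P Z) (hK : P.lastStep ≤ K) {ϑ : ℝ} (hϑ : 0 < ϑ) (hϑ1 : ϑ ≤ 1)
    (hchr : Chrono (PEv.step ∘ sh) G) {E : Finset ε} {G' : Gen ↥E} (hGG : gmap Subtype.val G' = G)
    (hN : 0 < n * L ^ K) :
    AdmZ (nearD n L K (levelOf s K) (theta (levelOf s K) ϑ))
      (fun t W => extD sh n L K (levelOf s K) ϑ G
        (regZoneD sh n L K (levelOf s K) 32 (regR sh pay n L K (levelOf s K))) t (gmap Subtype.val W))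
      ((PEv.step ∘ sh) ∘ Subtype.val) G' (fun b => placeD sh pay n L K hN (levelOf s K) b.1) := by
  have hL0 : 0 < L := by omega
  have hsK : ∀ u, u < K → s (u + 1) ≤ s u := fun u _ => hs u
  have hLF := levelFn_levelOf hsK (hdrop K)
  have hev : ∀ e ∈ G.events, (sh e).step ≤ K := fun e he => (events_step_le_of_corrZ P G Z hc hR e he).trans hK
  have hlvK : ∀ b : ↥E, b.1 ∈ births G → levelOf s K (sh b.1).step ≤ K := fun b hb =>
    hLF.le_K _ (hev b.1 (births_subset_events G hb))
  exact admZ_of_birthRegionsD (sh := sh) (by omega) hLF hϑ hϑ1 hchr hev (leafStep_of_corr P G hc)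
    (birthRegionsD_of_corrZ hL hn hs hdrop hc hR hK) hGG _
    (fun b hb => isScale_placeD sh pay hN (hlvK b hb))
    (fun b hb => block_placeD_mem sh pay hN hL0 (hlvK b hb) (births_facts_of_corrZ P G Z hc hR b.1 hb).2.1)

open scoped Classical in
/-- **THE (GM) MULTIPLICITY OF A ZONE-SKELETON CORRESPONDING HISTORY, WITH WINDOW-DROP STEPS** (part III's
`card_admZSet_le_of_corr_realises` with `Realises ↦ RealisesZ`; same shape and constants). [folklore] -/
theorem card_admZSet_le_of_corr_realisesZ (W : ε → ℕ) {P : PGen (Pt d × Finset (Pt d))} {G : Gen ε}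
    {Z : Finset (Pt d)} (hc : Corr sh pay G P) (hR : RealisesZ L s P Z) (hK : P.lastStep ≤ K) {σ : ℝ}
    (h0 : 0 < σ) (h1 : σ < 1) (hσL : 1 ≤ (L : ℝ) * σ ^ 4) (hW : G.WF W) (hchr : Chrono (PEv.step ∘ sh) G)
    (hk2 : ∀ m ∈ merges G, (sh m).kind ≠ 0) (E : Finset ε) (hE : G.events ⊆ E) (z c₀' : TCell d (n * L ^ K)) :
    ((admZSet (nearD n L K (levelOf s K) (theta (levelOf s K) (σ ^ 2)))
        (fun t W => extD sh n L K (levelOf s K) (σ ^ 2) G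
          (regZoneD sh n L K (levelOf s K) 32 (regR sh pay n L K (levelOf s K))) t (gmap Subtype.val W))
        ((PEv.step ∘ sh) ∘ Subtype.val) (grestrict E G hE) (grestrict E G hE).root z c₀').card : ℝ) ≤
      ((2 : ℝ) ^ d * (σ ^ 2)⁻¹ ^ d *
          (max ((4 : ℝ) * 2 ^ d + 2 * (32 : ℕ)) ((2 * (32 : ℕ) + 1) / (1 - σ ^ 2) + 1) +
            2 * ((2 * (32 : ℕ) + 1) / (1 - σ ^ 2)) + 1) ^ d) ^ (merges G).card *
        (∏ e ∈ merges G, Q (wcntS sh G) σ (sh e).step ^ (d : ℝ)) *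
          ((L : ℝ) ^ d) ^ partnerAges (PEv.step ∘ sh) G := by
  have hsK : ∀ u, u < K → s (u + 1) ≤ s u := fun u _ => hs u
  have hLF := levelFn_levelOf hsK (hdrop K)
  exact card_admZSet_le_of_birthRegionsD (sh := sh) W n (by omega) K hLF (by positivity) h0 h1 hσL hW hchr
    (fun b hb => (births_facts_of_corrZ P G Z hc hR b hb).1) hk2 (birthRegionsD_of_corrZ hL hn hs hdrop hc hR hK) E hE
    z c₀'

/-! ## §2 The print-exact twins of parts II–III -/

/-- **PRINT-EXACT TWIN of `birthRegionsD_of_corr`.** [folklore] -/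
theorem birthRegionsD_of_corrP {P : PGen (Pt d × Finset (Pt d))} {G : Gen ε} {Z : Finset (Pt d)}
    (hc : Corr sh pay G P) (hR : RealisesP L s R P Z) (hK : P.lastStep ≤ K) :
    BirthRegionsD sh n L K (levelOf s K) (4 * 2 ^ d) 32 G (regR sh pay n L K (levelOf s K)) :=
  birthRegionsD_of_corrZ hL hn hs hdrop hc (realisesZ_of_realisesP P Z hR) hK

/-- **PRINT-EXACT TWIN of `contact_of_corr`.** [folklore] -/
theorem contact_of_corrP {P : PGen (Pt d × Finset (Pt d))} {G : Gen ε} {Z : Finset (Pt d)}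
    (hc : Corr sh pay G P) (hR : RealisesP L s R P Z) (hK : P.lastStep ≤ K) {X Y : Gen ε} {e : ε}
    (hsub : Sub (Gen.merge X Y e) G) :
    ∃ z, z ∈ regZoneD sh n L K (levelOf s K) 32 (regR sh pay n L K (levelOf s K)) (sh e).step X ∧
      z ∈ regZoneD sh n L K (levelOf s K) 32 (regR sh pay n L K (levelOf s K)) (sh e).step Y :=
  contact_of_corrZ hL hn hs hdrop P G Z hc (realisesZ_of_realisesP P Z hR) hK X Y e hsub

open scoped Classical in
/-- **PRINT-EXACT TWIN of `admZ_of_corr_realises`.** [folklore] -/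
theorem admZ_of_corr_realisesP {P : PGen (Pt d × Finset (Pt d))} {G : Gen ε} {Z : Finset (Pt d)}
    (hc : Corr sh pay G P) (hR : RealisesP L s R P Z) (hK : P.lastStep ≤ K) {ϑ : ℝ} (hϑ : 0 < ϑ) (hϑ1 : ϑ ≤ 1)
    (hchr : Chrono (PEv.step ∘ sh) G) {E : Finset ε} {G' : Gen ↥E} (hGG : gmap Subtype.val G' = G)
    (hN : 0 < n * L ^ K) :
    AdmZ (nearD n L K (levelOf s K) (theta (levelOf s K) ϑ))
      (fun t W => extD sh n L K (levelOf s K) ϑ G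
        (regZoneD sh n L K (levelOf s K) 32 (regR sh pay n L K (levelOf s K))) t (gmap Subtype.val W))
      ((PEv.step ∘ sh) ∘ Subtype.val) G' (fun b => placeD sh pay n L K hN (levelOf s K) b.1) :=
  admZ_of_corr_realisesZ hL hn hs hdrop hc (realisesZ_of_realisesP P Z hR) hK hϑ hϑ1 hchr hGG hN

open scoped Classical in
/-- **PRINT-EXACT TWIN of `card_admZSet_le_of_corr_realises`.** [folklore] -/
theorem card_admZSet_le_of_corr_realisesP (W : ε → ℕ) {P : PGen (Pt d × Finset (Pt d))} {G : Gen ε}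
    {Z : Finset (Pt d)} (hc : Corr sh pay G P) (hR : RealisesP L s R P Z) (hK : P.lastStep ≤ K) {σ : ℝ}
    (h0 : 0 < σ) (h1 : σ < 1) (hσL : 1 ≤ (L : ℝ) * σ ^ 4) (hW : G.WF W) (hchr : Chrono (PEv.step ∘ sh) G)
    (hk2 : ∀ m ∈ merges G, (sh m).kind ≠ 0) (E : Finset ε) (hE : G.events ⊆ E) (z c₀' : TCell d (n * L ^ K)) :
    ((admZSet (nearD n L K (levelOf s K) (theta (levelOf s K) (σ ^ 2)))
        (fun t W => extD sh n L K (levelOf s K) (σ ^ 2) G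
          (regZoneD sh n L K (levelOf s K) 32 (regR sh pay n L K (levelOf s K))) t (gmap Subtype.val W))
        ((PEv.step ∘ sh) ∘ Subtype.val) (grestrict E G hE) (grestrict E G hE).root z c₀').card : ℝ) ≤
      ((2 : ℝ) ^ d * (σ ^ 2)⁻¹ ^ d *
          (max ((4 : ℝ) * 2 ^ d + 2 * (32 : ℕ)) ((2 * (32 : ℕ) + 1) / (1 - σ ^ 2) + 1) +
            2 * ((2 * (32 : ℕ) + 1) / (1 - σ ^ 2)) + 1) ^ d) ^ (merges G).card *
        (∏ e ∈ merges G, Q (wcntS sh G) σ (sh e).step ^ (d : ℝ)) *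
          ((L : ℝ) ^ d) ^ partnerAges (PEv.step ∘ sh) G :=
  card_admZSet_le_of_corr_realisesZ hL hn hs hdrop W hc (realisesZ_of_realisesP P Z hR) hK h0 h1 hσL hW hchr hk2 E
    hE z c₀'

end Walk

/-! ## §3 Part IV's pedigree corollaries over the zone skeleton, and their print-exact twins -/

section Component

variable {α π : Type*} (cellP : π → Pt d × Finset (Pt d)) [DecidableEq α] [DecidableEq π]
variable {L : ℕ} (hL : 3 ≤ L) {n : ℕ} (hn : 0 < n) {s : ℕ → ℕ} (hs : ∀ t, s (t + 1) ≤ s t)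
  (hdrop : ∀ m, DropCtl s m) {R : ℕ → ℕ} {K : ℕ}
include hL hn hs hdrop

/-- **THE LEVELLED BIRTH-REGION LAWS FOR A ZONE-SKELETON-REALISED COMPONENT OF A PEDIGREE** (part IV's
`birthRegionsD_genT` with `Realises ↦ RealisesZ`). [folklore] -/
theorem birthRegionsD_genTZ (P : Pedigree α π) (hS : ∀ c c', Part.old c' true ∈ P.parts c → P.step c' + 1 = P.step c)
    (c : α) {Z : Finset (Pt d)} (hR : RealisesZ L s (P.toPGen cellP c) Z) (hK : (P.toPGen cellP c).lastStep ≤ K) :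
    BirthRegionsD Prod.fst n L K (levelOf s K) (4 * 2 ^ d) 32 (P.genT c)
      (regR Prod.fst (payOfTag cellP) n L K (levelOf s K)) :=
  birthRegionsD_of_corrZ hL hn hs hdrop (corr_genT_toPGen cellP P hS c) hR hK

/-- **PRINT-EXACT TWIN of `birthRegionsD_genT`.** [folklore] -/
theorem birthRegionsD_genTP (P : Pedigree α π) (hS : ∀ c c', Part.old c' true ∈ P.parts c → P.step c' + 1 = P.step c)
    (c : α) {Z : Finset (Pt d)} (hR : RealisesP L s R (P.toPGen cellP c) Z) (hK : (P.toPGen cellP c).lastStep ≤ K) :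
    BirthRegionsD Prod.fst n L K (levelOf s K) (4 * 2 ^ d) 32 (P.genT c)
      (regR Prod.fst (payOfTag cellP) n L K (levelOf s K)) :=
  birthRegionsD_genTZ cellP hL hn hs hdrop P hS c (realisesZ_of_realisesP _ Z hR) hK

open scoped Classical in
/-- **THE REALISED PLACEMENT OF A ZONE-SKELETON-REALISED COMPONENT IS ZONE-ADMISSIBLE AT LEVELS** (part IV's
`admZ_genT_of_realises` with `Realises ↦ RealisesZ`). [folklore] -/
theorem admZ_genT_of_realisesZ (P : Pedigree α π)
    (hS : ∀ c c', Part.old c' true ∈ P.parts c → P.step c' + 1 = P.step c) (c : α) {Z : Finset (Pt d)}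
    (hR : RealisesZ L s (P.toPGen cellP c) Z) (hK : (P.toPGen cellP c).lastStep ≤ K) {ϑ : ℝ} (hϑ : 0 < ϑ)
    (hϑ1 : ϑ ≤ 1) (hchr : Chrono (PEv.step ∘ Prod.fst) (P.genT c)) {E : Finset (Lab α π)} {G' : Gen ↥E}
    (hGG : gmap Subtype.val G' = P.genT c) (hN : 0 < n * L ^ K) :
    AdmZ (nearD n L K (levelOf s K) (theta (levelOf s K) ϑ))
      (fun t W => extD Prod.fst n L K (levelOf s K) ϑ (P.genT c)
        (regZoneD Prod.fst n L K (levelOf s K) 32 (regR Prod.fst (payOfTag cellP) n L K (levelOf s K))) t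
        (gmap Subtype.val W))
      ((PEv.step ∘ Prod.fst) ∘ Subtype.val) G'
      (fun b => placeD Prod.fst (payOfTag cellP) n L K hN (levelOf s K) b.1) :=
  admZ_of_corr_realisesZ hL hn hs hdrop (corr_genT_toPGen cellP P hS c) hR hK hϑ hϑ1 hchr hGG hN

open scoped Classical in
/-- **PRINT-EXACT TWIN of `admZ_genT_of_realises`.** [folklore] -/
theorem admZ_genT_of_realisesP (P : Pedigree α π)
    (hS : ∀ c c', Part.old c' true ∈ P.parts c → P.step c' + 1 = P.step c) (c : α) {Z : Finset (Pt d)}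
    (hR : RealisesP L s R (P.toPGen cellP c) Z) (hK : (P.toPGen cellP c).lastStep ≤ K) {ϑ : ℝ} (hϑ : 0 < ϑ)
    (hϑ1 : ϑ ≤ 1) (hchr : Chrono (PEv.step ∘ Prod.fst) (P.genT c)) {E : Finset (Lab α π)} {G' : Gen ↥E}
    (hGG : gmap Subtype.val G' = P.genT c) (hN : 0 < n * L ^ K) :
    AdmZ (nearD n L K (levelOf s K) (theta (levelOf s K) ϑ))
      (fun t W => extD Prod.fst n L K (levelOf s K) ϑ (P.genT c)
        (regZoneD Prod.fst n L K (levelOf s K) 32 (regR Prod.fst (payOfTag cellP) n L K (levelOf s K))) t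
        (gmap Subtype.val W))
      ((PEv.step ∘ Prod.fst) ∘ Subtype.val) G'
      (fun b => placeD Prod.fst (payOfTag cellP) n L K hN (levelOf s K) b.1) :=
  admZ_genT_of_realisesZ cellP hL hn hs hdrop P hS c (realisesZ_of_realisesP _ Z hR) hK hϑ hϑ1 hchr hGG hN

open scoped Classical in
/-- **THE (GM) MULTIPLICITY OF A ZONE-SKELETON-REALISED COMPONENT, WITH WINDOW-DROP STEPS** (part IV's
`card_admZSet_genT_le_of_realises` with `Realises ↦ RealisesZ`). [folklore] -/
theorem card_admZSet_genT_le_of_realisesZ (W : Lab α π → ℕ) (P : Pedigree α π)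
    (hS : ∀ c c', Part.old c' true ∈ P.parts c → P.step c' + 1 = P.step c) (c : α) {Z : Finset (Pt d)}
    (hR : RealisesZ L s (P.toPGen cellP c) Z) (hK : (P.toPGen cellP c).lastStep ≤ K) {σ : ℝ} (h0 : 0 < σ)
    (h1 : σ < 1) (hσL : 1 ≤ (L : ℝ) * σ ^ 4) (hW : (P.genT c).WF W) (hchr : Chrono (PEv.step ∘ Prod.fst) (P.genT c))
    (hk2 : ∀ m ∈ merges (P.genT c), (Prod.fst m : PEv).kind ≠ 0) (E : Finset (Lab α π))
    (hE : (P.genT c).events ⊆ E) (z c₀' : TCell d (n * L ^ K)) :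
    ((admZSet (nearD n L K (levelOf s K) (theta (levelOf s K) (σ ^ 2)))
        (fun t W => extD Prod.fst n L K (levelOf s K) (σ ^ 2) (P.genT c)
          (regZoneD Prod.fst n L K (levelOf s K) 32 (regR Prod.fst (payOfTag cellP) n L K (levelOf s K))) t
          (gmap Subtype.val W))
        ((PEv.step ∘ Prod.fst) ∘ Subtype.val) (grestrict E (P.genT c) hE) (grestrict E (P.genT c) hE).root z c₀').card
        : ℝ) ≤
      ((2 : ℝ) ^ d * (σ ^ 2)⁻¹ ^ d *
          (max ((4 : ℝ) * 2 ^ d + 2 * (32 : ℕ)) ((2 * (32 : ℕ) + 1) / (1 - σ ^ 2) + 1) +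
            2 * ((2 * (32 : ℕ) + 1) / (1 - σ ^ 2)) + 1) ^ d) ^ (merges (P.genT c)).card *
        (∏ e ∈ merges (P.genT c), Q (wcntS Prod.fst (P.genT c)) σ (Prod.fst e : PEv).step ^ (d : ℝ)) *
          ((L : ℝ) ^ d) ^ partnerAges (PEv.step ∘ Prod.fst) (P.genT c) :=
  card_admZSet_le_of_corr_realisesZ hL hn hs hdrop W (corr_genT_toPGen cellP P hS c) hR hK h0 h1 hσL hW hchr hk2 E
    hE z c₀'

open scoped Classical in
/-- **PRINT-EXACT TWIN of `card_admZSet_genT_le_of_realises`.** [folklore] -/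
theorem card_admZSet_genT_le_of_realisesP (W : Lab α π → ℕ) (P : Pedigree α π)
    (hS : ∀ c c', Part.old c' true ∈ P.parts c → P.step c' + 1 = P.step c) (c : α) {Z : Finset (Pt d)}
    (hR : RealisesP L s R (P.toPGen cellP c) Z) (hK : (P.toPGen cellP c).lastStep ≤ K) {σ : ℝ} (h0 : 0 < σ)
    (h1 : σ < 1) (hσL : 1 ≤ (L : ℝ) * σ ^ 4) (hW : (P.genT c).WF W) (hchr : Chrono (PEv.step ∘ Prod.fst) (P.genT c))
    (hk2 : ∀ m ∈ merges (P.genT c), (Prod.fst m : PEv).kind ≠ 0) (E : Finset (Lab α π))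
    (hE : (P.genT c).events ⊆ E) (z c₀' : TCell d (n * L ^ K)) :
    ((admZSet (nearD n L K (levelOf s K) (theta (levelOf s K) (σ ^ 2)))
        (fun t W => extD Prod.fst n L K (levelOf s K) (σ ^ 2) (P.genT c)
          (regZoneD Prod.fst n L K (levelOf s K) 32 (regR Prod.fst (payOfTag cellP) n L K (levelOf s K))) t
          (gmap Subtype.val W))
        ((PEv.step ∘ Prod.fst) ∘ Subtype.val) (grestrict E (P.genT c) hE) (grestrict E (P.genT c) hE).root z c₀').card
        : ℝ) ≤
      ((2 : ℝ) ^ d * (σ ^ 2)⁻¹ ^ d *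
          (max ((4 : ℝ) * 2 ^ d + 2 * (32 : ℕ)) ((2 * (32 : ℕ) + 1) / (1 - σ ^ 2) + 1) +
            2 * ((2 * (32 : ℕ) + 1) / (1 - σ ^ 2)) + 1) ^ d) ^ (merges (P.genT c)).card *
        (∏ e ∈ merges (P.genT c), Q (wcntS Prod.fst (P.genT c)) σ (Prod.fst e : PEv).step ^ (d : ℝ)) *
          ((L : ℝ) ^ d) ^ partnerAges (PEv.step ∘ Prod.fst) (P.genT c) :=
  card_admZSet_genT_le_of_realisesZ cellP hL hn hs hdrop W P hS c (realisesZ_of_realisesP _ Z hR) hK h0 h1 hσL hW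
    hchr hk2 E hE z c₀'

end Component

/-! ## §4 Sanity -/

namespace SanityZOR6

/-- THE LANDED THEOREM RECOVERED: part II's `birthRegionsD_of_corr` (hypothesis `Realises`) is the zone-skeleton law
through bridge 1 — the two sides of the twin chain share one proof. [folklore] -/
example {ε : Type*} [DecidableEq ε] {sh : ε → PEv} {pay : ε → Pt d × Finset (Pt d)} {L : ℕ} (hL : 3 ≤ L) {n : ℕ}
    (hn : 0 < n) {s : ℕ → ℕ} (hs : ∀ t, s (t + 1) ≤ s t) (hdrop : ∀ m, DropCtl s m) {R : ℕ → ℕ} {K : ℕ}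
    {P : PGen (Pt d × Finset (Pt d))} {G : Gen ε} {Z : Finset (Pt d)} (hc : Corr sh pay G P)
    (hR : Realises L s R P Z) (hK : P.lastStep ≤ K) :
    BirthRegionsD sh n L K (levelOf s K) (4 * 2 ^ d) 32 G (regR sh pay n L K (levelOf s K)) :=
  birthRegionsD_of_corrZ hL hn hs hdrop hc (realisesZ_of_realises P Z hR) hK

end SanityZOR6

end

end Summit.QuantumFields.BalabanUV.T4Continuum.HistoryZones
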